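import Literature.NumberTheory.LFunctions.LandauGonekFormula
import Literature.NumberTheory.LFunctions.LandauGonekRightLineSharp
import HarnessLib

/-!
# Landau's formula over the zeros of `ζ`, uniformly in `x`: sharp resonance term

Topic: `Literature/NumberTheory/LFunctions`. THEOREMS (everything proved). A refinement of
`LandauGonek.landau_gonek_formula` (crude uniform form of Gonek 1993 Thm. 1, summed over
`|Im ρ| ≤ T`): with the right edge estimated by `LandauGonek.rightLine_bound_sharp` instead of
`LandauGonek.rightLine_bound`, the near-resonance term `min(T, x/⟨x⟩)` carries the factor `log(3x)`
in place of `x²`: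

* `landau_gonek_formula_sharp` — there is an absolute `C` with, for all real `x > 1` and `T ≥ 2`,
  `‖∑_{|Im ρ| ≤ T} m(ρ) x^ρ + (T/π) Λ(x)‖ ≤ C (x² ((1 + 1/log x)² (log T)² + log(3x)) + log(3x)·min(T, x/⟨x⟩))`.

This is again a corollary of [Gonek1993, Thm. 1], whose error
`O(x log(2xT) loglog 3x) + O(log x · min(T, x/⟨x⟩)) + O(log 2T · min(T, 1/log x))` it dominates term by
term; the point of the refinement is that in bilinear sums over the ratios `x = m/m'` of integers
`≤ M` the resonance term now costs `O(M² log M)` and not `O(M⁴)`.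
-- TODO(general form): Gonek's one-sided sum `0 < γ ≤ T` with the error terms as printed.

Proof: verbatim the proof of `landau_gonek_formula` (good height `T₁ ∈ [T, T+1]`, residue theorem
on `(−∞, 2] × [−T₁, T₁]`, horizontal half-lines `≪ x² log²T (1 + 1/log x)²`, `≪ log T` zeros between
`T` and `T₁`), with the right edge `= 2T₁Λ(x) + O(x² log 3x + log(3x) min(T₁, x/⟨x⟩))`.

## References

* S. M. Gonek, *An explicit formula of Landau and its applications to the theory of the
  zeta-function*, Contemp. Math. 143 (1993), 395–413, Thm. 1. [Gonek1993]
* E. Landau, *Über die Nullstellen der Zetafunktion*, Math. Ann. 71 (1911), 548–564. [Landau1911]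
-/

noncomputable section

open Complex Filter Set MeasureTheory Topology intervalIntegral
open ArithmeticFunction hiding log id
open scoped Real Interval

namespace Literature.NumberTheory.LFunctions

namespace LandauGonek

open PsiOneExplicit ExplicitPsi

set_option maxHeartbeats 800000 in
/-- **Landau's formula, uniformly in `x`, sharp resonance term.** There is an absolute constant `C`
such that for all real `x > 1` and `T ≥ 2`,
`‖∑_{|Im ρ| ≤ T} m(ρ) x^ρ + (T/π) Λ(x)‖ ≤ C (x²((1 + 1/log x)² (log T)² + log(3x)) + log(3x)·min(T, x/⟨x⟩))`,
where the sum runs over the non-trivial zeros `ρ` of `ζ` with `|Im ρ| ≤ T` (the finite set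
`weilZeroIndex T`) counted with multiplicity `m(ρ) = riemannZetaZeroOrder ρ`,
`Λ(x) = Λ(n)` if `x = n ∈ ℕ` and `Λ(x) = 0` otherwise, and `⟨x⟩ = primePowDist x` is the distance
from `x` to the nearest prime power other than `x`. [cite: Gonek1993, Thm. 1] -/
theorem landau_gonek_formula_sharp :
    ∃ C : ℝ, 0 < C ∧ ∀ x : ℝ, 1 < x → ∀ T : ℝ, 2 ≤ T →
      ‖∑ ρ ∈ (weilZeroIndex_finite T).toFinset, (riemannZetaZeroOrder ρ : ℂ) * (x : ℂ) ^ ρ +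
          (((T / π * (if ((⌊x⌋₊ : ℕ) : ℝ) = x then Λ ⌊x⌋₊ else 0)) : ℝ) : ℂ)‖ ≤
        C * (x ^ 2 * ((1 + 1 / Real.log x) ^ 2 * Real.log T ^ 2 + Real.log (3 * x)) +
          Real.log (3 * x) * min T (x / primePowDist x)) := by
  -- constants
  obtain ⟨CR, hCR0, hRight⟩ := rightLine_bound_sharp
  obtain ⟨Cr, hCr0, hCr⟩ := ZetaZeroSum.exists_norm_logDeriv_riemannXi_le_of_re_ge
  obtain ⟨Ch, hCh0, hCh⟩ := PsiOneExplicit.exists_norm_logDeriv_riemannZeta_horizontal_le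
  obtain ⟨c₀, hc₀0, hgoodH⟩ := exists_goodHeight_all
  obtain ⟨Cw, hCw0, hCw⟩ := exists_sum_zetaZeroWindow_le
  obtain ⟨δ, hδ0, hδ2, hgap⟩ := ZetaZeroSum.exists_gap_im
  set M₀ : ℝ := ∑' n : ℕ, ‖LSeries.term (fun n ↦ (ArithmeticFunction.vonMangoldt n : ℂ)) (3 / 2 : ℂ) n‖
    with hM₀
  have hM₀0 : 0 ≤ M₀ := tsum_nonneg fun _ ↦ norm_nonneg _
  set A₀ : ℝ := Cr + 19 + M₀ + 2 * Ch + Ch / c₀ with hA₀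
  have hA₀0 : 0 ≤ A₀ := by positivity
  refine ⟨70 + 2 * CR + 18 * A₀ + 24 * Cw, by positivity, fun x hx T hT ↦ ?_⟩
  classical
  -- basics
  have hx0 : 0 < x := by linarith
  set L : ℝ := Real.log x with hL
  have hL0 : 0 < L := Real.log_pos hx
  have hT0 : 0 < T := by linarith
  set Λr : ℝ := (if ((⌊x⌋₊ : ℕ) : ℝ) = x then Λ ⌊x⌋₊ else 0) with hΛr
  have hΛr0 : 0 ≤ Λr := by rw [hΛr]; split_ifs <;> simp [vonMangoldt_nonneg]
  have hΛrle : Λr ≤ x := by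
    rw [hΛr]
    split_ifs with h
    · calc Λ ⌊x⌋₊ ≤ Real.log (⌊x⌋₊ : ℝ) := vonMangoldt_le_log
        _ = L := by rw [h]
        _ ≤ x - 1 := Real.log_le_sub_one_of_pos hx0
        _ ≤ x := by linarith
    · exact hx0.le
  -- a good height `T₁ ∈ [T, T+1]`
  obtain ⟨T₁, hT₁, hT₁', η, hη0, hη1, hηinv, hZ⟩ := hgoodH T (by linarith)
  have hT₁2 : 2 ≤ T₁ := hT.trans hT₁
  have hT₁0 : 0 < T₁ := by linarith
  have hgood : ∀ ρ ∈ RHWave0.riemannZetaNontrivialZeros, ρ.im ≠ T₁ ∧ ρ.im ≠ -T₁ := by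
    intro ρ hρ
    obtain ⟨h1, h2⟩ := hZ ρ hρ
    refine ⟨fun h ↦ ?_, fun h ↦ ?_⟩
    · rw [h, sub_self, abs_zero] at h1; linarith
    · rw [h, neg_add_cancel, abs_zero] at h2; linarith
  have hZtop : ∀ ρ ∈ RHWave0.riemannZetaNontrivialZeros, η ≤ |ρ.im - T₁| := fun ρ hρ ↦ (hZ ρ hρ).1
  have hZbot : ∀ ρ ∈ RHWave0.riemannZetaNontrivialZeros, η ≤ |ρ.im - (-T₁)| := fun ρ hρ ↦ by
    rw [sub_neg_eq_add]; exact (hZ ρ hρ).2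
  -- `Λ₀` and its size
  set ℓ : ℝ := Real.log (T₁ + 4) with hℓ
  have hℓ1 : 1 ≤ ℓ := by
    rw [hℓ, Real.le_log_iff_exp_le (by linarith)]
    have := Real.exp_one_lt_d9
    linarith
  set Λ₀ : ℝ := Cr + 17 + 2 * ℓ + Ch * ℓ * (2 + ℓ / c₀) + M₀ with hΛ₀def
  have habsT : |T₁| = T₁ := abs_of_pos hT₁0
  have habsT' : |(-T₁)| = T₁ := by rw [abs_neg, habsT]
  have hlogT₁2 : Real.log (T₁ + 2) ≤ ℓ := Real.log_le_log (by linarith) (by linarith)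
  have hℓ0 : 0 ≤ ℓ := by linarith
  have hΛ₀ : ∀ t : ℝ, |t| = T₁ → Cr + 17 + 2 * Real.log |t| + Ch * Real.log (|t| + 4) / η + M₀ ≤ Λ₀ := by
    intro t ht
    rw [ht, ← hℓ]
    have hlogT₁ : Real.log T₁ ≤ ℓ := Real.log_le_log hT₁0 (by linarith)
    have h1 : Ch * ℓ / η ≤ Ch * ℓ * (2 + ℓ / c₀) := by
      rw [div_eq_mul_one_div]
      refine mul_le_mul_of_nonneg_left (hηinv.trans ?_) (by positivity)
      gcongr
    linarith
  have hΛ₀A : Λ₀ ≤ A₀ * ℓ ^ 2 := by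
    rw [hΛ₀def, hA₀]
    have hℓ2 : ℓ ≤ ℓ ^ 2 := le_self_pow₀ hℓ1 two_ne_zero
    have h1 : (1 : ℝ) ≤ ℓ ^ 2 := one_le_pow₀ hℓ1
    have h2 : Ch * ℓ * (2 + ℓ / c₀) = 2 * Ch * ℓ + Ch / c₀ * ℓ ^ 2 := by ring
    rw [h2]
    have p1 : 0 ≤ Cr * (ℓ ^ 2 - 1) := mul_nonneg hCr0.le (by linarith)
    have p2 : 0 ≤ M₀ * (ℓ ^ 2 - 1) := mul_nonneg hM₀0 (by linarith)
    have p3 : 0 ≤ Ch * (ℓ ^ 2 - ℓ) := mul_nonneg hCh0.le (by linarith)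
    have p4 : 0 ≤ Ch / c₀ := by positivity
    linarith [mul_comm (Ch / c₀) (ℓ ^ 2)]
  -- `ℓ ≤ 3 log T`
  have hlogT : Real.log 2 ≤ Real.log T := Real.log_le_log two_pos hT
  have hlog2 : (1 / 2 : ℝ) < Real.log 2 := by have := Real.log_two_gt_d9; linarith
  have hlogT0 : 1 / 2 < Real.log T := by linarith
  have hℓ3 : ℓ ≤ 3 * Real.log T := by
    have h4 : ℓ ≤ Real.log (4 * T) := Real.log_le_log (by linarith) (by linarith)
    have h44 : Real.log (4 * T) = Real.log 4 + Real.log T := Real.log_mul (by norm_num) hT0.ne'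
    have hl4 : Real.log 4 = 2 * Real.log 2 := by
      rw [show (4 : ℝ) = 2 ^ 2 by norm_num, Real.log_pow]; norm_num
    linarith
  -- the two horizontal half-lines (`b = 2`)
  obtain ⟨hint_top, hHtop⟩ := horizontal_integral_bound_cpow hCr hCh hx (t := T₁)
    (by rw [habsT]; exact hT₁2) hη0 hη1 hZtop (hΛ₀ T₁ habsT) hCh0.le hCr0.le
  obtain ⟨hint_bot, hHbot⟩ := horizontal_integral_bound_cpow hCr hCh hx (t := -T₁)
    (by rw [habsT']; exact hT₁2) hη0 hη1 hZbot (hΛ₀ (-T₁) habsT') hCh0.le hCr0.le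
  -- the contour (`b = 2`)
  have hB := rightEdge_identity_cpow hx (by norm_num : (1 : ℝ) < 2) hδ0 hgap
    (by linarith : (1 : ℝ) ≤ T₁) hgood hint_top hint_bot
  -- the right line
  have hR := hRight x hx T₁ hT₁0
  -- the zeros between `T` and `T₁`
  have hS := norm_zeroSum_sub_le_cpow hx.le hT₁
  have hD := sum_order_sdiff_le hCw hT0.le hT₁'
  -- names
  set G : ℂ → ℂ := fun s ↦ (-deriv riemannZeta s / riemannZeta s) * (x : ℂ) ^ s with hG
  set V : ℂ := ∫ t in (-T₁)..T₁, G (((2 : ℝ) : ℂ) + t * I) with hV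
  set Hb : ℂ := ∫ σ in Iic (2 : ℝ), G ((σ : ℂ) + (-T₁ : ℝ) * I) with hHb
  set Ht : ℂ := ∫ σ in Iic (2 : ℝ), G ((σ : ℂ) + T₁ * I) with hHt
  set S₁ : ℂ := ∑ ρ ∈ (weilZeroIndex_finite T₁).toFinset,
    (riemannZetaZeroOrder ρ : ℂ) * (x : ℂ) ^ ρ with hS₁
  set S : ℂ := ∑ ρ ∈ (weilZeroIndex_finite T).toFinset,
    (riemannZetaZeroOrder ρ : ℂ) * (x : ℂ) ^ ρ with hSdef
  set cx : ℂ := ((((x ^ 2 - 1)⁻¹ : ℝ)) : ℂ) with hcx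
  set D : ℝ := ∑ ρ ∈ (weilZeroIndex_finite T₁).toFinset \ (weilZeroIndex_finite T).toFinset,
    (riemannZetaZeroOrder ρ : ℝ) with hDdef
  have hπ0 : (0 : ℝ) < π := Real.pi_pos
  have hπC : (π : ℂ) ≠ 0 := by exact_mod_cast hπ0.ne'
  have hnorm2π : ‖(2 * π : ℂ)‖ = 2 * π := by
    rw [show (2 * π : ℂ) = ((2 * π : ℝ) : ℂ) by norm_cast, Complex.norm_real, Real.norm_eq_abs,
      abs_of_pos (by positivity)]
  -- `V = 2π (x − S₁ − cx) + i (Hb − Ht)`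
  have hVeq : V = 2 * π * ((x : ℂ) - S₁ - cx) + I * (Hb - Ht) := by
    have hI : I * I = -1 := I_mul_I
    have hB' : I * V = 2 * π * I * ((x : ℂ) - S₁ - cx) - Hb + Ht := by
      rw [hV, hHb, hHt, hS₁, hcx]
      exact hB
    linear_combination (-I) * hB' + (V - 2 * π * ((x : ℂ) - S₁ - cx)) * hI
  -- the right line in our names
  have hR' : ‖V - (((2 * T₁ * Λr : ℝ)) : ℂ)‖ ≤
      CR * (x ^ 2 * Real.log (3 * x) + Real.log (3 * x) * min T₁ (x / primePowDist x)) := by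
    rw [hV, hΛr]; exact hR
  -- the target, decomposed
  have htarget : S + (((T / π * Λr : ℝ)) : ℂ) =
      (S - S₁) + ((x : ℂ) - cx) - (V - (((2 * T₁ * Λr : ℝ)) : ℂ)) / (2 * π) +
        I * (Hb - Ht) / (2 * π) - ((((T₁ - T) / π * Λr : ℝ)) : ℂ) := by
    rw [hVeq]
    push_cast
    field_simp
    ring
  -- sizes: `Q = x² (1 + 1/L)² log² T`, `R = x² log(3x)`, `P = log(3x) min(T, x/⟨x⟩)`
  set Q : ℝ := x ^ 2 * ((1 + 1 / L) ^ 2 * Real.log T ^ 2) with hQ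
  set L₃ : ℝ := Real.log (3 * x) with hL₃
  have hL₃1 : 1 < L₃ := one_lt_log_three_mul hx
  have hL₃0 : 0 < L₃ := by linarith
  set R : ℝ := x ^ 2 * L₃ with hRdef
  set P : ℝ := L₃ * min T (x / primePowDist x) with hP
  have hpd := primePowDist_pos x
  have hmin0 : 0 ≤ min T (x / primePowDist x) := le_min hT0.le (by positivity)
  have hP0 : 0 ≤ P := by positivity
  have hR0 : 0 ≤ R := by positivity
  have hL₃R : L₃ ≤ R := by
    rw [hRdef]
    exact le_mul_of_one_le_left hL₃0.le (one_le_pow₀ hx.le)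
  have hx2 : x ≤ x ^ 2 := le_self_pow₀ hx.le two_ne_zero
  have hx21 : 1 < x ^ 2 := one_lt_pow₀ hx two_ne_zero
  have h1L : 0 < 1 / L := by positivity
  have hfac1 : 1 ≤ (1 + 1 / L) ^ 2 := one_le_pow₀ (by linarith)
  have hfacL : 1 / L ≤ (1 + 1 / L) ^ 2 :=
    calc 1 / L ≤ 1 + 1 / L := by linarith
      _ ≤ (1 + 1 / L) ^ 2 := le_self_pow₀ (by linarith) two_ne_zero
  have hfacL2 : 1 / L ^ 2 ≤ (1 + 1 / L) ^ 2 := by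
    rw [← one_div_pow]
    exact pow_le_pow_left₀ h1L.le (by linarith) 2
  have hlogsq : 1 / 4 ≤ Real.log T ^ 2 :=
    calc (1 / 4 : ℝ) = (1 / 2) ^ 2 := by norm_num
      _ ≤ Real.log T ^ 2 := pow_le_pow_left₀ (by norm_num) hlogT0.le 2
  have hfl : 1 / 4 ≤ (1 + 1 / L) ^ 2 * Real.log T ^ 2 :=
    calc (1 / 4 : ℝ) = 1 * (1 / 4) := by ring
      _ ≤ (1 + 1 / L) ^ 2 * Real.log T ^ 2 := mul_le_mul hfac1 hlogsq (by norm_num) (by positivity)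
  have hQx2 : x ^ 2 ≤ 4 * Q := by
    rw [hQ]
    calc x ^ 2 = 4 * (x ^ 2 * (1 / 4)) := by ring
      _ ≤ 4 * (x ^ 2 * ((1 + 1 / L) ^ 2 * Real.log T ^ 2)) := by gcongr
  have hQ0 : 0 ≤ Q := by positivity
  have hQlog : x ^ 2 * Real.log T ^ 2 ≤ Q := by
    rw [hQ]; exact mul_le_mul_of_nonneg_left (le_mul_of_one_le_left (by positivity) hfac1) (by positivity)
  have hQL : x ^ 2 * Real.log T ^ 2 / L ≤ Q := by
    rw [hQ, div_eq_mul_one_div]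
    calc x ^ 2 * Real.log T ^ 2 * (1 / L) = x ^ 2 * ((1 / L) * Real.log T ^ 2) := by ring
      _ ≤ x ^ 2 * ((1 + 1 / L) ^ 2 * Real.log T ^ 2) := by gcongr
  have hQL2 : x ^ 2 / L ^ 2 ≤ 4 * Q := by
    rw [hQ, div_eq_mul_one_div]
    calc x ^ 2 * (1 / L ^ 2) ≤ x ^ 2 * ((1 + 1 / L) ^ 2 * 1) := by
          rw [mul_one]; exact mul_le_mul_of_nonneg_left hfacL2 (by positivity)
      _ ≤ x ^ 2 * ((1 + 1 / L) ^ 2 * (4 * Real.log T ^ 2)) := by gcongr; linarith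
      _ = 4 * (x ^ 2 * ((1 + 1 / L) ^ 2 * Real.log T ^ 2)) := by ring
  have hcxL : (x ^ 2 - 1)⁻¹ ≤ 2 * Q := by
    have h1 : 2 * L ≤ x ^ 2 - 1 := two_mul_log_le_sq_sub_one hx0
    have h2 : (x ^ 2 - 1)⁻¹ ≤ (2 * L)⁻¹ := by
      rw [inv_le_inv₀ (by linarith) (by positivity)]; exact h1
    refine h2.trans ?_
    have h3 : (1 : ℝ) ≤ 4 * (x ^ 2 * Real.log T ^ 2) :=
      calc (1 : ℝ) = 4 * (1 * (1 / 4)) := by ring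
        _ ≤ 4 * (x ^ 2 * Real.log T ^ 2) := by gcongr
    calc (2 * L)⁻¹ = 1 / 2 * (1 / L) * 1 := by rw [mul_inv, one_div, one_div, mul_one]
      _ ≤ 1 / 2 * (1 / L) * (4 * (x ^ 2 * Real.log T ^ 2)) := by gcongr
      _ = 2 * (x ^ 2 * Real.log T ^ 2 / L) := by ring
      _ ≤ 2 * Q := by linarith
  -- (i) `x − 1/(x²−1)`
  have h_i : ‖(x : ℂ) - cx‖ ≤ 6 * Q := by
    have hcxn : ‖cx‖ = (x ^ 2 - 1)⁻¹ := by
      rw [hcx, Complex.norm_real, Real.norm_eq_abs, abs_of_pos (inv_pos.2 (sub_pos.2 hx21))]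
    have hxn : ‖(x : ℂ)‖ = x := by rw [Complex.norm_real, Real.norm_eq_abs, abs_of_pos hx0]
    calc ‖(x : ℂ) - cx‖ ≤ ‖(x : ℂ)‖ + ‖cx‖ := norm_sub_le _ _
      _ = x + (x ^ 2 - 1)⁻¹ := by rw [hxn, hcxn]
      _ ≤ 4 * Q + 2 * Q := add_le_add (hx2.trans hQx2) hcxL
      _ = 6 * Q := by ring
  -- (ii) the right line
  have hmin1 : min T₁ (x / primePowDist x) ≤ min T (x / primePowDist x) + 1 := by
    calc min T₁ (x / primePowDist x) ≤ min (T + 1) (x / primePowDist x + 1) :=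
          min_le_min hT₁' (by linarith)
      _ = min T (x / primePowDist x) + 1 := min_add_add_right T (x / primePowDist x) 1
  have h_ii : ‖(V - (((2 * T₁ * Λr : ℝ)) : ℂ)) / (2 * π)‖ ≤ CR * (2 * R + P) := by
    rw [norm_div, hnorm2π]
    have h2π : (1 : ℝ) ≤ 2 * π := by linarith [Real.pi_gt_three]
    calc ‖V - (((2 * T₁ * Λr : ℝ)) : ℂ)‖ / (2 * π) ≤ ‖V - (((2 * T₁ * Λr : ℝ)) : ℂ)‖ :=
          div_le_self (norm_nonneg _) h2π
      _ ≤ CR * (x ^ 2 * Real.log (3 * x) + Real.log (3 * x) * min T₁ (x / primePowDist x)) := hR'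
      _ ≤ CR * (x ^ 2 * Real.log (3 * x) + Real.log (3 * x) * (min T (x / primePowDist x) + 1)) := by
          gcongr
      _ = CR * (R + L₃ + P) := by rw [hRdef, hP, hL₃]; ring
      _ ≤ CR * (2 * R + P) := by
          refine mul_le_mul_of_nonneg_left ?_ hCR0.le
          linarith [hL₃R]
  -- (iii) the horizontal integrals
  have he : (20 : ℝ) / Real.exp 1 ≤ 15 / 2 := by
    rw [div_le_iff₀ (Real.exp_pos 1)]
    have := Real.exp_one_gt_d9
    linarith
  have hH : ∀ H : ℂ, ‖H‖ ≤ x ^ 2 * (Λ₀ / Real.log x + 20 / (Real.exp 1 * Real.log x ^ 2)) →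
      ‖H‖ ≤ (9 * A₀ + 30) * Q := by
    intro H hH
    refine hH.trans ?_
    rw [← hL]
    have hℓ9 : ℓ ^ 2 ≤ 9 * Real.log T ^ 2 := by
      calc ℓ ^ 2 ≤ (3 * Real.log T) ^ 2 := pow_le_pow_left₀ hℓ0 hℓ3 2
        _ = 9 * Real.log T ^ 2 := by ring
    have h1 : x ^ 2 * (Λ₀ / L) ≤ 9 * A₀ * Q := by
      calc x ^ 2 * (Λ₀ / L) ≤ x ^ 2 * (A₀ * (9 * Real.log T ^ 2) / L) := by gcongr; exact hΛ₀A.trans (by gcongr)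
        _ = 9 * A₀ * (x ^ 2 * Real.log T ^ 2 / L) := by ring
        _ ≤ 9 * A₀ * Q := mul_le_mul_of_nonneg_left hQL (by positivity)
    have h2 : x ^ 2 * (20 / (Real.exp 1 * L ^ 2)) ≤ 30 * Q := by
      calc x ^ 2 * (20 / (Real.exp 1 * L ^ 2)) = 20 / Real.exp 1 * (x ^ 2 / L ^ 2) := by
            field_simp
        _ ≤ 15 / 2 * (4 * Q) := mul_le_mul he hQL2 (by positivity) (by norm_num)
        _ = 30 * Q := by ring
    calc x ^ 2 * (Λ₀ / L + 20 / (Real.exp 1 * L ^ 2))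
        = x ^ 2 * (Λ₀ / L) + x ^ 2 * (20 / (Real.exp 1 * L ^ 2)) := by ring
      _ ≤ 9 * A₀ * Q + 30 * Q := add_le_add h1 h2
      _ = (9 * A₀ + 30) * Q := by ring
  have h_iii : ‖I * (Hb - Ht) / (2 * π)‖ ≤ 2 * (9 * A₀ + 30) * Q := by
    rw [norm_div, norm_mul, Complex.norm_I, one_mul, hnorm2π]
    have h2π : (1 : ℝ) ≤ 2 * π := by linarith [Real.pi_gt_three]
    have hb' := hH Hb hHbot
    have ht' := hH Ht hHtop
    calc ‖Hb - Ht‖ / (2 * π) ≤ ‖Hb - Ht‖ := div_le_self (norm_nonneg _) h2π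
      _ ≤ ‖Hb‖ + ‖Ht‖ := norm_sub_le _ _
      _ ≤ (9 * A₀ + 30) * Q + (9 * A₀ + 30) * Q := add_le_add hb' ht'
      _ = 2 * (9 * A₀ + 30) * Q := by ring
  -- (iv) the zeros between `T` and `T₁`
  have h_iv : ‖S - S₁‖ ≤ 24 * Cw * Q := by
    rw [norm_sub_rev]
    refine hS.trans ?_
    have hlog52 : Real.log (T + 5 / 2) ≤ 3 * Real.log T := by
      have h4 : Real.log (T + 5 / 2) ≤ Real.log (4 * T) := Real.log_le_log (by linarith) (by linarith)
      rw [Real.log_mul (by norm_num) hT0.ne', show (4 : ℝ) = 2 * 2 by norm_num,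
        Real.log_mul two_ne_zero two_ne_zero] at h4
      linarith
    have hlsq : Real.log T ≤ 2 * Real.log T ^ 2 :=
      calc Real.log T = Real.log T * 1 := by ring
        _ ≤ Real.log T * (2 * Real.log T) := mul_le_mul_of_nonneg_left (by linarith) (by linarith)
        _ = 2 * Real.log T ^ 2 := by ring
    have hxpos : 0 ≤ x := hx0.le
    calc x * D ≤ x * (4 * Cw * Real.log (T + 5 / 2)) := mul_le_mul_of_nonneg_left hD hxpos
      _ ≤ x * (4 * Cw * (3 * (2 * Real.log T ^ 2))) := by
          refine mul_le_mul_of_nonneg_left ?_ hxpos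
          exact mul_le_mul_of_nonneg_left (hlog52.trans (by linarith)) (by positivity)
      _ = 24 * Cw * (x * Real.log T ^ 2) := by ring
      _ ≤ 24 * Cw * (x ^ 2 * Real.log T ^ 2) := by gcongr
      _ ≤ 24 * Cw * Q := mul_le_mul_of_nonneg_left hQlog (by positivity)
  -- (v) the main term between `T` and `T₁`
  have h_v : ‖((((T₁ - T) / π * Λr : ℝ)) : ℂ)‖ ≤ 4 * Q := by
    rw [Complex.norm_real, Real.norm_eq_abs, abs_of_nonneg (by positivity)]
    have h1 : (T₁ - T) / π ≤ 1 := by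
      rw [div_le_one hπ0]; linarith [Real.pi_gt_three]
    calc (T₁ - T) / π * Λr ≤ 1 * Λr := mul_le_mul_of_nonneg_right h1 hΛr0
      _ ≤ x ^ 2 := by rw [one_mul]; exact hΛrle.trans hx2
      _ ≤ 4 * Q := hQx2
  -- conclusion
  rw [htarget]
  have hCQ : 6 * Q + CR * (2 * R + P) + 2 * (9 * A₀ + 30) * Q + 24 * Cw * Q + 4 * Q ≤
      (70 + 2 * CR + 18 * A₀ + 24 * Cw) *
        (x ^ 2 * ((1 + 1 / L) ^ 2 * Real.log T ^ 2 + Real.log (3 * x)) +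
          Real.log (3 * x) * min T (x / primePowDist x)) := by
    have e : (70 + 2 * CR + 18 * A₀ + 24 * Cw) *
        (x ^ 2 * ((1 + 1 / L) ^ 2 * Real.log T ^ 2 + Real.log (3 * x)) +
          Real.log (3 * x) * min T (x / primePowDist x)) -
        (6 * Q + CR * (2 * R + P) + 2 * (9 * A₀ + 30) * Q + 24 * Cw * Q + 4 * Q) =
        (70 + 18 * A₀ + 24 * Cw) * R + 2 * CR * Q + (70 + CR + 18 * A₀ + 24 * Cw) * P := by
      rw [hQ, hP, hRdef, hL₃]; ring
    have p1 : 0 ≤ (70 + 18 * A₀ + 24 * Cw) * R := by positivity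
    have p2 : 0 ≤ (70 + CR + 18 * A₀ + 24 * Cw) * P := by positivity
    have p3 : 0 ≤ 2 * CR * Q := by positivity
    linarith
  calc ‖S - S₁ + ((x : ℂ) - cx) - (V - (((2 * T₁ * Λr : ℝ)) : ℂ)) / (2 * π) +
          I * (Hb - Ht) / (2 * π) - ((((T₁ - T) / π * Λr : ℝ)) : ℂ)‖
      ≤ ‖S - S₁‖ + ‖(x : ℂ) - cx‖ + ‖(V - (((2 * T₁ * Λr : ℝ)) : ℂ)) / (2 * π)‖ +
          ‖I * (Hb - Ht) / (2 * π)‖ + ‖((((T₁ - T) / π * Λr : ℝ)) : ℂ)‖ := by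
        refine (norm_sub_le _ _).trans ?_
        refine add_le_add ((norm_add_le _ _).trans (add_le_add ((norm_sub_le _ _).trans
          (add_le_add (norm_add_le _ _) le_rfl)) le_rfl)) le_rfl
    _ ≤ 24 * Cw * Q + 6 * Q + CR * (2 * R + P) + 2 * (9 * A₀ + 30) * Q + 4 * Q := by
        gcongr
    _ ≤ (70 + 2 * CR + 18 * A₀ + 24 * Cw) *
        (x ^ 2 * ((1 + 1 / L) ^ 2 * Real.log T ^ 2 + Real.log (3 * x)) +
          Real.log (3 * x) * min T (x / primePowDist x)) := by linarith

end LandauGonek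

end Literature.NumberTheory.LFunctions

end
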